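import Summits.QuantumAdvantage.QuantumAdvantage.Theses.LinnikCubicClassGroups
import Literature.NumberTheory.CubicFields.PeriodicChainCellsGrid
import Mathlib.Analysis.SpecialFunctions.Log.Basic
import Mathlib.Analysis.Complex.ExponentialBounds

/-!
# Crux `LinnikCubicClassGroups.PureCubicClassGroupFBQP` (stmt-QuantumAdvantage-11544) — stub `stub_classTableSem`, part CELLS

Line `arakelov-giant-step-cycle`, stub `stub_classTableSem` (S5b-P5b): clause (vi) of the structural interface of the class table
for the IDEAL cell function `C_g(i) = (Lab (idx (i R/2^s)), ⌊(i R/2^s − G(idx ·)) 2^npp⌋₊)` of one class circle (`G` the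
logarithmic chain with period `n₀`, `R`, exactly periodic labels `Lab`): the fibres are two runs
(`cell_grid_fibre_two_runs`) and there are at most `2^npp (R + LB) + n₀ + 1 ≤ 2^(npp+5) (27a²b²)^6` values
(`cell_grid_image_card_le`, `R, LB ≤ |d_K|^6`, `n₀ log 2 ≤ 6 R`, `|d_K| ≤ 27 a²b²`).
-/

set_option linter.dupNamespace false

namespace Summit.QuantumAdvantage.QuantumAdvantage.Theorems.LinnikCubicClassGroups

open Literature.NumberTheory.CubicFields

/-- **The cell count, numerically**: `2^npp (R + LB) + n₀ + 1 ≤ 2^(npp+5) (27a²b²)^6`. -/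
theorem num_ncell {npp n₀ a b : ℕ} {R LB d : ℝ} (hLB0 : 0 ≤ LB) (hLB : LB ≤ d ^ 6) (hRd : R ≤ d ^ 6)
    (hn₀R : (n₀ : ℝ) * Real.log 2 ≤ 6 * R) (hd : 1 ≤ d) (hdab : d ≤ 27 * (a : ℝ) ^ 2 * (b : ℝ) ^ 2) :
    2 ^ npp * (R + LB) + n₀ + 1 ≤ ((2 ^ (npp + 5) * (27 * a ^ 2 * b ^ 2) ^ 6 : ℕ) : ℝ) := by
  have hl2 := Real.log_two_gt_d9
  have hd6 : (1 : ℝ) ≤ d ^ 6 := one_le_pow₀ hd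
  have hn₀ : (n₀ : ℝ) ≤ 9 * d ^ 6 := by nlinarith
  have hpow : d ^ 6 ≤ (27 * (a : ℝ) ^ 2 * (b : ℝ) ^ 2) ^ 6 := pow_le_pow_left₀ (by linarith) hdab 6
  have h2 : (1 : ℝ) ≤ 2 ^ npp := one_le_pow₀ (by norm_num)
  push_cast
  rw [pow_add]
  nlinarith [mul_le_mul_of_nonneg_left hpow (by positivity : (0 : ℝ) ≤ 2 ^ npp)]

/-- **Clause (vi) for one class circle.** -/
theorem cells_package {G : ℤ → ℝ} (hG : StrictMono G) {n₀ : ℕ} (hn₀ : 0 < n₀) {R : ℝ} (hper : ∀ i, G (i + n₀) = G i + R)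
    {idx : ℝ → ℤ} (hidx : ∀ x, G (idx x) ≤ x ∧ x < G (idx x + 1)) {Lab : ℤ → ℕ × List ℤ}
    (hLab : ∀ i j, Lab i = Lab j ↔ (n₀ : ℤ) ∣ i - j) (s npp : ℕ) {LB d : ℝ} (hgap : ∀ k, G (k + 1) - G k ≤ LB)
    (hLB0 : 0 ≤ LB) (hLB : LB ≤ d ^ 6) (hRd : R ≤ d ^ 6) (hn₀R : (n₀ : ℝ) * Real.log 2 ≤ 6 * R) (hd : 1 ≤ d)
    {a b : ℕ} (hdab : d ≤ 27 * (a : ℝ) ^ 2 * (b : ℝ) ^ 2) :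
    (∀ ω ∈ (Finset.range (2 ^ s)).image (fun i : ℕ => (Lab (idx (i * (R / ((2 ^ s : ℕ) : ℝ)))),
        ⌊(i * (R / ((2 ^ s : ℕ) : ℝ)) - G (idx (i * (R / ((2 ^ s : ℕ) : ℝ))))) * (2 : ℝ) ^ npp⌋₊)),
      ∃ b₁ b₂ b₁' b₂' : ℕ, Disjoint (Finset.Ico b₁ b₂) (Finset.Ico b₁' b₂') ∧
        (Finset.range (2 ^ s)).filter (fun i : ℕ => (Lab (idx (i * (R / ((2 ^ s : ℕ) : ℝ)))),
          ⌊(i * (R / ((2 ^ s : ℕ) : ℝ)) - G (idx (i * (R / ((2 ^ s : ℕ) : ℝ))))) * (2 : ℝ) ^ npp⌋₊) = ω) =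
          Finset.Ico b₁ b₂ ∪ Finset.Ico b₁' b₂') ∧
    ((Finset.range (2 ^ s)).image (fun i : ℕ => (Lab (idx (i * (R / ((2 ^ s : ℕ) : ℝ)))),
        ⌊(i * (R / ((2 ^ s : ℕ) : ℝ)) - G (idx (i * (R / ((2 ^ s : ℕ) : ℝ))))) * (2 : ℝ) ^ npp⌋₊))).card ≤
      2 ^ (npp + 5) * (27 * a ^ 2 * b ^ 2) ^ 6 := by
  classical
  have hN : (0 : ℝ) < (2 : ℝ) ^ npp := by positivity
  have hS : 0 < 2 ^ s := by positivity
  refine ⟨fun ω _ => cell_grid_fibre_two_runs hG hn₀ hper hidx hLab hN hS ω, ?_⟩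
  have h := cell_grid_image_card_le hG hn₀ hper hidx (Lab := Lab) hN hS hgap
  have h2 := num_ncell (npp := npp) (n₀ := n₀) (a := a) (b := b) hLB0 hLB hRd hn₀R hd hdab
  exact_mod_cast h.trans h2


/-- **P5b helper `classTableSem_cells_package`** (registered): clause (vi) for one class circle. -/
theorem classTableSem_cells_package : ∀ (G : ℤ → ℝ), StrictMono G → ∀ (n₀ : ℕ), 0 < n₀ → ∀ (R : ℝ), (∀ i, G (i + n₀) = G i + R) → ∀ (idx : ℝ → ℤ), (∀ x, G (idx x) ≤ x ∧ x < G (idx x + 1)) → ∀ (Lab : ℤ → ℕ × List ℤ), (∀ i j, Lab i = Lab j ↔ (n₀ : ℤ) ∣ i - j) → ∀ (s npp : ℕ) (LB d : ℝ), (∀ k, G (k + 1) - G k ≤ LB) → 0 ≤ LB → LB ≤ d ^ 6 → R ≤ d ^ 6 → (n₀ : ℝ) * Real.log 2 ≤ 6 * R → 1 ≤ d → ∀ (a b : ℕ), d ≤ 27 * (a : ℝ) ^ 2 * (b : ℝ) ^ 2 → (∀ ω ∈ (Finset.range (2 ^ s)).image (fun i : ℕ => (Lab (idx (i * (R / ((2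 ^ s : ℕ) : ℝ)))), ⌊(i * (R / ((2 ^ s : ℕ) : ℝ)) - G (idx (i * (R / ((2 ^ s : ℕ) : ℝ))))) * (2 : ℝ) ^ npp⌋₊)), ∃ b₁ b₂ b₁' b₂' : ℕ, Disjoint (Finset.Ico b₁ b₂) (Finset.Ico b₁' b₂') ∧ (Finset.range (2 ^ s)).filter (fun i : ℕ => (Lab (idx (i * (R / ((2 ^ s : ℕ) : ℝ)))), ⌊(i * (R / ((2 ^ s : ℕ) : ℝ)) - G (idx (i * (R / ((2 ^ s : ℕ) : ℝ))))) * (2 : ℝ) ^ npp⌋₊) = ω) = Finset.Ico b₁ b₂ ∪ Finset.Ico b₁' b₂') ∧ ((Finset.range (2 ^ s)).image (fun i : ℕ => (Lab (idx (i * (R / ((2 ^ s : ℕ) : ℝ)))), ⌊(i * (R / ((2 ^ s : ℕ) : ℝ)) - G (idx (i * (R / ((2 ^ s : ℕ) : ℝ))))) * (2 : ℝ) ^ npp⌋₊))).card ≤ 2 ^ (npp + 5) * (27 * a ^ 2 * b ^ 2) ^ 6 :=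
  fun _ hG _ hn₀ _ hper _ hidx _ hLab s npp _ _ hgap hLB0 hLB hRd hn₀R hd _ _ hdab =>
    cells_package hG hn₀ hper hidx hLab s npp hgap hLB0 hLB hRd hn₀R hd hdab

end Summit.QuantumAdvantage.QuantumAdvantage.Theorems.LinnikCubicClassGroups
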